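import Summits.BirchSwinnertonDyer.BirchSwinnertonDyer.Theorems.KimAtThreeFineKatoKPortInertia
import Literature.NumberTheory.LFunctions.DworkRationalityLiftingTraceProofs
import HarnessLib

/-!
# K-PORT glue: a FROBENIUS LIFT generates `Gal(K/ℚ_p)` for an UNRAMIFIED finite `K ⊇ ℚ_p` —
# `Fix⟨φ⟩ = ℚ_p`, `K/ℚ_p` is Galois, `ord φ = [K : ℚ_p]`, `⟨φ⟩ = Gal(K/ℚ_p)`; hence `φ^{[K:ℚ_p]} = 1`
# with pairwise distinct lower powers (the binders of the Euler-lattice index theorem)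
# (cell `bsd-addord`, seat w2-kport gen 7; `--supports stmt-BirchSwinnertonDyer-19560`, helper)

HONEST FRAMING. Route W2 (`route-BirchSwinnertonDyer-KimAtThreeKolyvagin`), crux 19560
`KatoKuriharaPortThreeShared`; the E-side LATTICE LEMMA `log_ω E(K_w) = E_p(φ)⁻¹𝒪_w` of the
good-ANOMALOUS rows (items 19679 / 19599, support item 20397; w2-acc3 gens 6–7). Its algebraic half,
`KimAtThreeEulerLatticeIndex.relIndex_integer_eulerLattice` (acc3, p521580), is stated for an isometric
`ℚ_p`-algebra endomorphism `φ` of a `p`-adic field `K` with `[K : ℚ_p] = f` under the two GLOBAL-looking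
binders `hpow : ∀ x, (φ ^ f) x = x` and `hdist : φ⁰, …, φ^{f−1}` pairwise distinct, while the analytic
half (`EulerLattice.norm_frobeniusCombination_padicLog_le`, p518993) only knows the LOCAL hypothesis
`hφp : ∀ x, ‖x‖ ≤ 1 → ‖φ x − x ^ p‖ < 1` (`φ` lifts the `p`-power map of the residue field) and
unramifiedness `hK : ‖x‖ < 1 → ‖x‖ ≤ ‖p‖`. This file closes that gap ONCE in the port's abstract currency
(`[NontriviallyNormedField K] [NormedAlgebra ℚ_[p] K] [IsUltrametricDist K] [FiniteDimensional ℚ_[p] K]`,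
as in `…KPortResidueField` / `…KPortInertia`): a Frobenius lift of an unramified `K` GENERATES
`Aut_{ℚ_p}(K)`, `K/ℚ_p` is Galois, and `ord φ = [K : ℚ_p]` — so `hpow`/`hdist` follow from `hK` + `hφp`
alone (§4), with no appeal to the global Frobenius of a cyclotomic field. PROOF (Serre, *Local Fields*,
I §7–§8 / III §5, rearranged as in `…KPortInertia` to avoid the fundamental identity `e·f = n`, which the
tree does not have for an abstract `K`): if `φu = u` with `u ∈ 𝒪_K` then `ū^p = ū`, so `ū` lies in the
prime field (the `p` naturals `< p` exhaust the roots of `X^p − X`; tree lemma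
`Literature.NumberTheory.LFunctions.Dwork.exists_natCast_eq_of_pow_eq`), i.e. `u ∈ ℕ + 𝔪_K = ℕ + p𝒪_K`
(`hK`) with the quotient again `φ`-fixed; iterating, `u ∈ closure(ℚ_p) = ℚ_p`. Hence `Fix⟨φ⟩ = ⊥`, and
Artin's theorem (`[K : Fix⟨φ⟩] = |⟨φ⟩|`, Mathlib `IntermediateField.finrank_fixedField_eq_card`) gives the
rest. TOOL theorems only (no definition, no named fact, no `sorry`); closes nothing by itself; nothing
booked; BSD is not proved by any of this.

## What is proved (`φ` a FROBENIUS LIFT: `hφp : ∀ x, ‖x‖ ≤ 1 → ‖φ x − x ^ p‖ < 1`; `K` unramified: `hK`)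

* §1 `exists_norm_sub_natCast_lt_one` (`‖u‖ ≤ 1`, `‖u^p − u‖ < 1 ⇒ ‖u − m‖ < 1` for a natural `m < p`;
  the prime-field lemma `x ^ p = x ⇒ x = m` is the tree's `Dwork.exists_natCast_eq_of_pow_eq`).
* §2 (descent to `ℚ_p`, `φ : K →ₐ[ℚ_[p]] K`) `exists_norm_sub_algebraMap_le_pow`,
  `mem_range_algebraMap_of_norm_le_one_of_apply_eq`, **`mem_range_algebraMap_of_apply_eq`**
  (`φ`-fixed elements of an unramified `K` lie in `ℚ_p`).
* §3 (`φ : K ≃ₐ[ℚ_[p]] K`) **`fixedField_zpowers_eq_bot_of_frobeniusLift`**, **`isGalois_of_frobeniusLift`**,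
  **`orderOf_eq_finrank_of_frobeniusLift`**, **`zpowers_eq_top_of_frobeniusLift`**,
  `card_algEquiv_eq_finrank_of_frobeniusLift`, `isCyclic_algEquiv_of_frobeniusLift`,
  `eq_pow_of_frobeniusLift` (every automorphism is a power of `φ`), `algEquiv_eq_of_frobeniusLift`
  (UNIQUENESS of the Frobenius lift).
* §4 (the index theorem's binders, `φ : K →ₐ[ℚ_[p]] K`) `norm_algHom_eq` (isometry),
  **`pow_finrank_apply_eq_of_frobeniusLift`** (`(φ ^ [K:ℚ_p]) x = x`),
  **`eq_of_pow_eq_pow_of_frobeniusLift`** (`i, j < [K:ℚ_p]`, `⇑(φ^i) = ⇑(φ^j) ⇒ i = j`),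
  `pow_apply_eq_self_iff_of_frobeniusLift` (`φ^i = 1 ↔ [K:ℚ_p] ∣ i`), `algHom_eq_of_frobeniusLift`.

References: J.-P. Serre, *Local Fields* (1979), Ch. I §7–§8, Ch. III §5, Ch. IV §1 [SerreLocalFields1979];
J. W. S. Cassels, *Local Fields* (1986), Ch. 7 [Cassels1986]; E. Artin, fixed fields (Mathlib
`IntermediateField.finrank_fixedField_eq_card`).
-/

noncomputable section

-- the cell's Theorems namespace `Summit.BirchSwinnertonDyer.BirchSwinnertonDyer.…` repeats the summit name by design (D-0017)
set_option linter.dupNamespace false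

open scoped Classical NNReal

namespace Summit.BirchSwinnertonDyer.BirchSwinnertonDyer.Theorems.KPort

open Summit.BirchSwinnertonDyer.Rank1Residual.Additive.BallEval
open Literature.NumberTheory.GaloisRepresentations.LubinTate (unitBall mem_unitBall_iff)
open IntermediateField (fixedField)

/-! ## §1 Residues in the prime field: `ū^p = ū ⇒ u ≡ m (mod 𝔪_K)` for a natural `m < p` -/

section PrimeField

variable {p : ℕ} [hp : Fact p.Prime]

variable {K : Type*} [NontriviallyNormedField K] [NormedAlgebra ℚ_[p] K] [IsUltrametricDist K]

/-- An integral element `u ∈ 𝒪_K` with `ū ^ p = ū` (`‖u^p − u‖ < 1`) is congruent modulo `𝔪_K` to a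
natural number `m < p` (its residue lies in the prime field `𝔽_p ⊆ k`).
[cite: SerreLocalFields1979, Ch. I §7–§8] -/
theorem exists_norm_sub_natCast_lt_one {u : K} (hu : ‖u‖ ≤ 1) (h : ‖u ^ p - u‖ < 1) :
    ∃ m : ℕ, m < p ∧ ‖u - m‖ < 1 := by
  haveI := charP_residueField_unitBall p K
  let a : unitBall K := ⟨u, (mem_unitBall_iff K).mpr hu⟩
  have hres : IsLocalRing.residue (unitBall K) a ^ p = IsLocalRing.residue (unitBall K) a := by
    rw [← map_pow, residue_eq_residue_iff_norm_sub_lt_one]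
    simpa [a] using h
  obtain ⟨m, hm, hmu⟩ := Literature.NumberTheory.LFunctions.Dwork.exists_natCast_eq_of_pow_eq (p := p) hres
  refine ⟨m, hm, ?_⟩
  have h2 : IsLocalRing.residue (unitBall K) a = IsLocalRing.residue (unitBall K) (m : unitBall K) := by
    rw [← hmu, map_natCast]
  rw [residue_eq_residue_iff_norm_sub_lt_one] at h2
  simpa [a] using h2

end PrimeField

/-! ## §2 Descent to `ℚ_p`: `φ`-fixed elements of an unramified `K` are in `ℚ_p` -/

section Descent

variable {p : ℕ} [hp : Fact p.Prime] {K : Type*} [NontriviallyNormedField K] [NormedAlgebra ℚ_[p] K]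
  [IsUltrametricDist K]

/-- **Residue descent to `ℚ_p`.** Let `K` be unramified (`hK : 𝔪_K = p𝒪_K`) and `φ` a FROBENIUS LIFT
(`‖φx − x^p‖ < 1` on `𝒪_K`). Then every `φ`-fixed `u ∈ 𝒪_K` is within `‖p‖ⁿ` of `ℚ_p` for every `n`:
`ū^p = ū ⇒ u ≡ m (mod p𝒪_K)`, and `(u − m)/p` is again `φ`-fixed in `𝒪_K`.
[cite: SerreLocalFields1979, Ch. I §7–§8 and Ch. III §5] -/
theorem exists_norm_sub_algebraMap_le_pow (hK : ∀ x : K, ‖x‖ < 1 → ‖x‖ ≤ ‖(p : K)‖)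
    {φ : K →ₐ[ℚ_[p]] K} (hφp : ∀ x : K, ‖x‖ ≤ 1 → ‖φ x - x ^ p‖ < 1)
    (n : ℕ) {u : K} (hu : ‖u‖ ≤ 1) (hφu : φ u = u) :
    ∃ c : ℚ_[p], ‖u - algebraMap ℚ_[p] K c‖ ≤ ‖(p : K)‖ ^ n := by
  induction n generalizing u with
  | zero => exact ⟨0, by rw [map_zero, sub_zero, pow_zero]; exact hu⟩
  | succ n ih =>
    have h1 : ‖u ^ p - u‖ < 1 := by
      have h := hφp u hu
      rwa [hφu, ← norm_neg, neg_sub] at h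
    obtain ⟨m, -, hum⟩ := exists_norm_sub_natCast_lt_one (p := p) hu h1
    obtain ⟨x, hx, hpx⟩ := exists_eq_prime_mul_of_norm_lt_one (p := p) hK hum
    have hp0 : (p : K) ≠ 0 := norm_pos_iff.mp (norm_p_pos_lt (p := p) (K := K)).1
    have hφx : φ x = x := by
      have e : φ (u - m) = u - m := by rw [map_sub, hφu, map_natCast]
      rw [hpx, map_mul, map_natCast] at e
      exact mul_left_cancel₀ hp0 e
    obtain ⟨c, hc⟩ := ih hx hφx
    refine ⟨m + p * c, ?_⟩
    have e : u - algebraMap ℚ_[p] K (m + p * c) = p * (x - algebraMap ℚ_[p] K c) := by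
      rw [map_add, map_mul, map_natCast, map_natCast, mul_sub, ← hpx]; ring
    rw [e, norm_mul, pow_succ']
    exact mul_le_mul_of_nonneg_left hc (norm_nonneg _)

/-- … hence a `φ`-fixed `u ∈ 𝒪_K` lies IN `ℚ_p` (`ℚ_p ⊆ K` is a finite-dimensional, hence closed,
`ℚ_p`-subspace). [cite: SerreLocalFields1979, Ch. I §7–§8 and Ch. III §5] -/
theorem mem_range_algebraMap_of_norm_le_one_of_apply_eq
    (hK : ∀ x : K, ‖x‖ < 1 → ‖x‖ ≤ ‖(p : K)‖)
    {φ : K →ₐ[ℚ_[p]] K} (hφp : ∀ x : K, ‖x‖ ≤ 1 → ‖φ x - x ^ p‖ < 1)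
    {u : K} (hu : ‖u‖ ≤ 1) (hφu : φ u = u) : u ∈ Set.range (algebraMap ℚ_[p] K) := by
  let V : Submodule ℚ_[p] K := LinearMap.range (Algebra.linearMap ℚ_[p] K)
  have hV : (V : Set K) = Set.range (algebraMap ℚ_[p] K) := by
    ext y
    simp only [V, SetLike.mem_coe, LinearMap.mem_range, Algebra.linearMap_apply, Set.mem_range]
  have hclosed : IsClosed (V : Set K) := Submodule.closed_of_finiteDimensional V
  have hmem : u ∈ closure (V : Set K) := by
    rw [Metric.mem_closure_iff]
    intro ε hε
    obtain ⟨n, hn⟩ := exists_norm_prime_pow_lt (p := p) (K := K) hε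
    obtain ⟨c, hc⟩ := exists_norm_sub_algebraMap_le_pow hK hφp n hu hφu
    refine ⟨algebraMap ℚ_[p] K c, ?_, by rw [dist_eq_norm]; exact lt_of_le_of_lt hc hn⟩
    rw [hV]; exact ⟨c, rfl⟩
  rw [hclosed.closure_eq, hV] at hmem
  exact hmem

/-- **`K^φ = ℚ_p`.** Every `φ`-fixed element of an unramified `K` (Frobenius lift `φ`) lies in `ℚ_p`
(scale into `𝒪_K` by a power of `p`). [cite: SerreLocalFields1979, Ch. I §7–§8 and Ch. III §5] -/
theorem mem_range_algebraMap_of_apply_eq (hK : ∀ x : K, ‖x‖ < 1 → ‖x‖ ≤ ‖(p : K)‖)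
    {φ : K →ₐ[ℚ_[p]] K} (hφp : ∀ x : K, ‖x‖ ≤ 1 → ‖φ x - x ^ p‖ < 1)
    {x : K} (hφx : φ x = x) : x ∈ Set.range (algebraMap ℚ_[p] K) := by
  by_cases hx : x = 0
  · exact ⟨0, by rw [hx, map_zero]⟩
  have hp0 : (p : K) ≠ 0 := norm_pos_iff.mp (norm_p_pos_lt (p := p) (K := K)).1
  obtain ⟨n, hn⟩ := exists_norm_prime_pow_lt (p := p) (K := K) (inv_pos.mpr (norm_pos_iff.mpr hx))
  have hxn : ‖(p : K) ^ n * x‖ ≤ 1 := by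
    rw [norm_mul, norm_pow, ← le_div_iff₀ (norm_pos_iff.mpr hx), one_div]
    exact hn.le
  have hfix : φ ((p : K) ^ n * x) = (p : K) ^ n * x := by rw [map_mul, map_pow, map_natCast, hφx]
  obtain ⟨c, hc⟩ := mem_range_algebraMap_of_norm_le_one_of_apply_eq hK hφp hxn hfix
  refine ⟨((p : ℚ_[p]) ^ n)⁻¹ * c, ?_⟩
  rw [map_mul, map_inv₀, map_pow, map_natCast, hc, ← mul_assoc, inv_mul_cancel₀ (pow_ne_zero _ hp0),
    one_mul]

end Descent

/-! ## §3 A Frobenius lift generates `Gal(K/ℚ_p)`: `Fix⟨φ⟩ = ⊥`, Galois, `ord φ = [K : ℚ_p]`, `⟨φ⟩ = ⊤` -/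

section Generator

variable {p : ℕ} [hp : Fact p.Prime] {K : Type*} [NontriviallyNormedField K] [NormedAlgebra ℚ_[p] K]
  [IsUltrametricDist K] [FiniteDimensional ℚ_[p] K]

/-- **`Fix⟨φ⟩ = ℚ_p`** for a Frobenius lift `φ ∈ Aut_{ℚ_p}(K)` of an unramified `K`.
[cite: SerreLocalFields1979, Ch. I §7–§8 and Ch. III §5] -/
theorem fixedField_zpowers_eq_bot_of_frobeniusLift (hK : ∀ x : K, ‖x‖ < 1 → ‖x‖ ≤ ‖(p : K)‖)
    (φ : K ≃ₐ[ℚ_[p]] K) (hφp : ∀ x : K, ‖x‖ ≤ 1 → ‖φ x - x ^ p‖ < 1) :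
    fixedField (Subgroup.zpowers φ) = ⊥ := by
  refine le_antisymm (fun x hx => ?_) bot_le
  rw [mem_fixedField_zpowers_iff] at hx
  rw [IntermediateField.mem_bot]
  exact mem_range_algebraMap_of_apply_eq hK (φ := (φ : K →ₐ[ℚ_[p]] K)) (fun y hy => hφp y hy) hx

/-- **An unramified `K ⊇ ℚ_p` admitting a Frobenius lift is GALOIS over `ℚ_p`** (`Fix(Aut) ⊆ Fix⟨φ⟩ = ⊥`).
[cite: SerreLocalFields1979, Ch. I §7–§8 and Ch. III §5] -/
theorem isGalois_of_frobeniusLift (hK : ∀ x : K, ‖x‖ < 1 → ‖x‖ ≤ ‖(p : K)‖)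
    (φ : K ≃ₐ[ℚ_[p]] K) (hφp : ∀ x : K, ‖x‖ ≤ 1 → ‖φ x - x ^ p‖ < 1) : IsGalois ℚ_[p] K := by
  apply IsGalois.of_fixedField_eq_bot
  refine le_bot_iff.mp ?_
  rw [← fixedField_zpowers_eq_bot_of_frobeniusLift hK φ hφp]
  intro x hx
  rw [IntermediateField.mem_fixedField_iff] at hx ⊢
  exact fun f _ => hx f (Subgroup.mem_top f)

/-- **`ord φ = [K : ℚ_p]`** for a Frobenius lift `φ` of an unramified `K` (Artin: `[K : Fix⟨φ⟩] = |⟨φ⟩|`).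
[cite: SerreLocalFields1979, Ch. I §7–§8 and Ch. III §5] -/
theorem orderOf_eq_finrank_of_frobeniusLift (hK : ∀ x : K, ‖x‖ < 1 → ‖x‖ ≤ ‖(p : K)‖)
    (φ : K ≃ₐ[ℚ_[p]] K) (hφp : ∀ x : K, ‖x‖ ≤ 1 → ‖φ x - x ^ p‖ < 1) :
    orderOf φ = Module.finrank ℚ_[p] K := by
  have hbot := fixedField_zpowers_eq_bot_of_frobeniusLift hK φ hφp
  have h1 : Module.finrank (fixedField (Subgroup.zpowers φ)) K = orderOf φ := by
    rw [IntermediateField.finrank_fixedField_eq_card, Nat.card_zpowers]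
  have h2 : Module.finrank ℚ_[p] (fixedField (Subgroup.zpowers φ)) = 1 := by
    rw [hbot]; exact IntermediateField.finrank_bot
  have h3 := Module.finrank_mul_finrank ℚ_[p] (fixedField (Subgroup.zpowers φ)) K
  rw [h1, h2, one_mul] at h3
  exact h3

/-- **`⟨φ⟩ = Aut_{ℚ_p}(K)`**: a Frobenius lift GENERATES the automorphism group of an unramified `K`.
[cite: SerreLocalFields1979, Ch. I §7–§8 and Ch. III §5] -/
theorem zpowers_eq_top_of_frobeniusLift (hK : ∀ x : K, ‖x‖ < 1 → ‖x‖ ≤ ‖(p : K)‖)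
    (φ : K ≃ₐ[ℚ_[p]] K) (hφp : ∀ x : K, ‖x‖ ≤ 1 → ‖φ x - x ^ p‖ < 1) :
    Subgroup.zpowers φ = ⊤ := by
  rw [← IntermediateField.fixingSubgroup_fixedField (Subgroup.zpowers φ),
    fixedField_zpowers_eq_bot_of_frobeniusLift hK φ hφp, IntermediateField.fixingSubgroup_bot]

/-- `|Aut_{ℚ_p}(K)| = [K : ℚ_p]` for an unramified `K` with a Frobenius lift. [cite: SerreLocalFields1979, Ch. III §5] -/
theorem card_algEquiv_eq_finrank_of_frobeniusLift (hK : ∀ x : K, ‖x‖ < 1 → ‖x‖ ≤ ‖(p : K)‖)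
    (φ : K ≃ₐ[ℚ_[p]] K) (hφp : ∀ x : K, ‖x‖ ≤ 1 → ‖φ x - x ^ p‖ < 1) :
    Nat.card (K ≃ₐ[ℚ_[p]] K) = Module.finrank ℚ_[p] K := by
  haveI := isGalois_of_frobeniusLift hK φ hφp
  exact IsGalois.card_aut_eq_finrank ℚ_[p] K

/-- `Aut_{ℚ_p}(K)` is cyclic for an unramified `K` with a Frobenius lift. [cite: SerreLocalFields1979, Ch. III §5] -/
theorem isCyclic_algEquiv_of_frobeniusLift (hK : ∀ x : K, ‖x‖ < 1 → ‖x‖ ≤ ‖(p : K)‖)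
    (φ : K ≃ₐ[ℚ_[p]] K) (hφp : ∀ x : K, ‖x‖ ≤ 1 → ‖φ x - x ^ p‖ < 1) :
    IsCyclic (K ≃ₐ[ℚ_[p]] K) :=
  isCyclic_iff_exists_zpowers_eq_top.mpr ⟨φ, zpowers_eq_top_of_frobeniusLift hK φ hφp⟩

/-- Every `ℚ_p`-automorphism of an unramified `K` is a power `φ ^ i`, `i < [K : ℚ_p]`, of a Frobenius lift.
[cite: SerreLocalFields1979, Ch. III §5] -/
theorem eq_pow_of_frobeniusLift (hK : ∀ x : K, ‖x‖ < 1 → ‖x‖ ≤ ‖(p : K)‖)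
    (φ : K ≃ₐ[ℚ_[p]] K) (hφp : ∀ x : K, ‖x‖ ≤ 1 → ‖φ x - x ^ p‖ < 1) (σ : K ≃ₐ[ℚ_[p]] K) :
    ∃ i : ℕ, i < Module.finrank ℚ_[p] K ∧ φ ^ i = σ := by
  have hσ : σ ∈ Subgroup.zpowers φ := by
    rw [zpowers_eq_top_of_frobeniusLift hK φ hφp]; exact Subgroup.mem_top σ
  rw [← (isOfFinOrder_of_finite φ).mem_powers_iff_mem_zpowers] at hσ
  obtain ⟨n, rfl⟩ := hσ
  have hpos : 0 < orderOf φ := (isOfFinOrder_of_finite φ).orderOf_pos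
  refine ⟨n % orderOf φ, ?_, ?_⟩
  · rw [← orderOf_eq_finrank_of_frobeniusLift hK φ hφp]; exact Nat.mod_lt n hpos
  · exact pow_mod_orderOf φ n

/-- **Uniqueness of the Frobenius lift**: two Frobenius lifts `φ, ψ ∈ Aut_{ℚ_p}(K)` of an unramified
`K` coincide (`ψ⁻¹φ` is inertial; `…KPortInertia.algEquiv_eq_of_forall_norm_sub_lt_one`).
[cite: SerreLocalFields1979, Ch. I §7–§8 and Ch. IV §1] -/
theorem algEquiv_eq_of_frobeniusLift (hK : ∀ x : K, ‖x‖ < 1 → ‖x‖ ≤ ‖(p : K)‖)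
    (φ ψ : K ≃ₐ[ℚ_[p]] K) (hφp : ∀ x : K, ‖x‖ ≤ 1 → ‖φ x - x ^ p‖ < 1)
    (hψp : ∀ x : K, ‖x‖ ≤ 1 → ‖ψ x - x ^ p‖ < 1) : φ = ψ :=
  algEquiv_eq_of_forall_norm_sub_lt_one hK φ ψ fun x hx => by
    rw [show φ x - ψ x = (φ x - x ^ p) + (x ^ p - ψ x) by ring]
    refine lt_of_le_of_lt (IsUltrametricDist.norm_add_le_max _ _) (max_lt (hφp x hx) ?_)
    rw [norm_sub_rev]; exact hψp x hx

end Generator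

/-! ## §4 The binders of the Euler-lattice index theorem from LOCAL data (`φ : K →ₐ[ℚ_[p]] K`) -/

section IndexBinders

variable {p : ℕ} [hp : Fact p.Prime] {K : Type*} [NontriviallyNormedField K] [NormedAlgebra ℚ_[p] K]
  [IsUltrametricDist K] [FiniteDimensional ℚ_[p] K]

omit [IsUltrametricDist K] in
/-- A `ℚ_p`-algebra endomorphism of a finite `K ⊇ ℚ_p` is an ISOMETRY (it is bijective, and the norm of
`K` is the unique extension of `|·|_p`; `…KPortEquivariance.norm_algEquiv_eq`). [cite: Cassels1986, Ch. 7] -/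
theorem norm_algHom_eq (φ : K →ₐ[ℚ_[p]] K) (x : K) : ‖φ x‖ = ‖x‖ := by
  haveI : Algebra.IsAlgebraic ℚ_[p] K := Algebra.IsAlgebraic.of_finite ℚ_[p] K
  exact norm_algEquiv_eq (AlgEquiv.ofBijective φ (Algebra.IsAlgebraic.algHom_bijective φ)) x

omit [IsUltrametricDist K] [FiniteDimensional ℚ_[p] K] in
/-- Powers of `φ` and of the automorphism `AlgEquiv.ofBijective φ` agree pointwise. [folklore] -/
theorem ofBijective_pow_apply (φ : K →ₐ[ℚ_[p]] K) (hφ : Function.Bijective φ) (n : ℕ) (x : K) :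
    (AlgEquiv.ofBijective φ hφ ^ n) x = (φ ^ n) x := by
  rw [AlgEquiv.coe_pow, AlgHom.coe_pow]
  exact congrFun (congrArg (fun g : K → K => g^[n]) (funext fun y => rfl)) x

/-- **`φ ^ [K : ℚ_p] = 1`** (pointwise) for a Frobenius lift `φ : K →ₐ[ℚ_[p]] K` of an unramified `K` —
binder `hpow` of `KimAtThreeEulerLatticeIndex.relIndex_integer_eulerLattice` from `hK` + `hφp`.
[cite: SerreLocalFields1979, Ch. III §5] -/
theorem pow_finrank_apply_eq_of_frobeniusLift (hK : ∀ x : K, ‖x‖ < 1 → ‖x‖ ≤ ‖(p : K)‖)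
    (φ : K →ₐ[ℚ_[p]] K) (hφp : ∀ x : K, ‖x‖ ≤ 1 → ‖φ x - x ^ p‖ < 1) (x : K) :
    (φ ^ Module.finrank ℚ_[p] K) x = x := by
  haveI : Algebra.IsAlgebraic ℚ_[p] K := Algebra.IsAlgebraic.of_finite ℚ_[p] K
  have hbij := Algebra.IsAlgebraic.algHom_bijective φ
  have hord := orderOf_eq_finrank_of_frobeniusLift hK (AlgEquiv.ofBijective φ hbij)
    (fun y hy => hφp y hy)
  have h1 : AlgEquiv.ofBijective φ hbij ^ Module.finrank ℚ_[p] K = 1 := by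
    rw [← hord]; exact pow_orderOf_eq_one _
  rw [← ofBijective_pow_apply φ hbij, h1, AlgEquiv.one_apply]

/-- **The powers `φ⁰, …, φ^{[K:ℚ_p]−1}` are pairwise distinct** (as functions) for a Frobenius lift
`φ : K →ₐ[ℚ_[p]] K` of an unramified `K` — binder `hdist` of
`KimAtThreeEulerLatticeIndex.relIndex_integer_eulerLattice` from `hK` + `hφp`.
[cite: SerreLocalFields1979, Ch. III §5] -/
theorem eq_of_pow_eq_pow_of_frobeniusLift (hK : ∀ x : K, ‖x‖ < 1 → ‖x‖ ≤ ‖(p : K)‖)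
    (φ : K →ₐ[ℚ_[p]] K) (hφp : ∀ x : K, ‖x‖ ≤ 1 → ‖φ x - x ^ p‖ < 1) (i j : ℕ)
    (hi : i < Module.finrank ℚ_[p] K) (hj : j < Module.finrank ℚ_[p] K)
    (h : (⇑(φ ^ i) : K → K) = ⇑(φ ^ j)) : i = j := by
  haveI : Algebra.IsAlgebraic ℚ_[p] K := Algebra.IsAlgebraic.of_finite ℚ_[p] K
  have hbij := Algebra.IsAlgebraic.algHom_bijective φ
  have hord := orderOf_eq_finrank_of_frobeniusLift hK (AlgEquiv.ofBijective φ hbij)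
    (fun y hy => hφp y hy)
  have he : AlgEquiv.ofBijective φ hbij ^ i = AlgEquiv.ofBijective φ hbij ^ j := by
    apply AlgEquiv.ext
    intro y
    rw [ofBijective_pow_apply, ofBijective_pow_apply, h]
  rw [← hord] at hi hj
  exact pow_injOn_Iio_orderOf hi hj he

/-- `φ ^ i` acts trivially iff `[K : ℚ_p] ∣ i`, for a Frobenius lift `φ : K →ₐ[ℚ_[p]] K` of an unramified `K`.
[cite: SerreLocalFields1979, Ch. III §5] -/
theorem pow_apply_eq_self_iff_of_frobeniusLift (hK : ∀ x : K, ‖x‖ < 1 → ‖x‖ ≤ ‖(p : K)‖)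
    (φ : K →ₐ[ℚ_[p]] K) (hφp : ∀ x : K, ‖x‖ ≤ 1 → ‖φ x - x ^ p‖ < 1) (i : ℕ) :
    (∀ x : K, (φ ^ i) x = x) ↔ Module.finrank ℚ_[p] K ∣ i := by
  haveI : Algebra.IsAlgebraic ℚ_[p] K := Algebra.IsAlgebraic.of_finite ℚ_[p] K
  have hbij := Algebra.IsAlgebraic.algHom_bijective φ
  have hord := orderOf_eq_finrank_of_frobeniusLift hK (AlgEquiv.ofBijective φ hbij)
    (fun y hy => hφp y hy)
  rw [← hord, orderOf_dvd_iff_pow_eq_one]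
  constructor
  · intro h
    apply AlgEquiv.ext
    intro y
    rw [ofBijective_pow_apply, h, AlgEquiv.one_apply]
  · intro h x
    rw [← ofBijective_pow_apply φ hbij, h, AlgEquiv.one_apply]

/-- **Uniqueness of the Frobenius lift** (endomorphism form): two `ℚ_p`-algebra endomorphisms of an
unramified finite `K` lifting the `p`-power map of the residue field are equal.
[cite: SerreLocalFields1979, Ch. I §7–§8 and Ch. IV §1] -/
theorem algHom_eq_of_frobeniusLift (hK : ∀ x : K, ‖x‖ < 1 → ‖x‖ ≤ ‖(p : K)‖)
    (φ ψ : K →ₐ[ℚ_[p]] K) (hφp : ∀ x : K, ‖x‖ ≤ 1 → ‖φ x - x ^ p‖ < 1)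
    (hψp : ∀ x : K, ‖x‖ ≤ 1 → ‖ψ x - x ^ p‖ < 1) : φ = ψ := by
  haveI : Algebra.IsAlgebraic ℚ_[p] K := Algebra.IsAlgebraic.of_finite ℚ_[p] K
  have h := algEquiv_eq_of_frobeniusLift hK
    (AlgEquiv.ofBijective φ (Algebra.IsAlgebraic.algHom_bijective φ))
    (AlgEquiv.ofBijective ψ (Algebra.IsAlgebraic.algHom_bijective ψ))
    (fun y hy => hφp y hy) (fun y hy => hψp y hy)
  apply AlgHom.ext
  intro x
  exact AlgEquiv.congr_fun h x

end IndexBinders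

end Summit.BirchSwinnertonDyer.BirchSwinnertonDyer.Theorems.KPort

end
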